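import Summits.AtomisticToContinuum.HydrodynamicLimit.Theorems.OneFlightGossipEngineCollisionActivityTailsEndpointTails
import HarnessLib

/-!
# `TransferActivityTails` (stmt-AtomisticToContinuum-16624), line `Sketch` (card `predictor-drift-doob`):
# measure-theoretic tools for the transfer (file 1 of 3)

Helper file (`--supports stmt-AtomisticToContinuum-16624`) for the crux
`Summit.AtomisticToContinuum.HydrodynamicLimit.Theses.TwoClocks.TransferActivityTails`, skeleton
`Cruxes/TransferActivityTails/Lines/Sketch_a1.lean` (lead a1), registered stub `stub_driftTransfer`.  General
`lintegral ∘ ofReal` bookkeeping used by the transfer: Markov's inequality in real-valued form, linearity over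
empirical averages and finite sums, the indicator integrand, the convexity of the hinge `y ↦ (y − M)₊` over a block
average, the pointwise step `a𝟙{V < a} ≤ 2(b − M')₊ + 2M'𝟙{V_e < b}` for `a ≤ 2b`, `2V_e ≤ V`, and — on an abstract
probability space with `n + 1` spheres — the HINGE PART `Σ_i E(ā_i − M')₊ ≤ (n+1)B` of the transfer (registered
sub-goal `stub_driftTransferHingePart`) and the block means `Σ_i E X_{ij} ≤ (n+1)(M+δ)`.  All elementary.
-/

noncomputable section

open MeasureTheory Filter Set Topology
open scoped ENNReal BigOperators

namespace Summit.AtomisticToContinuum.HydrodynamicLimit.Theorems.TransferActivityTailsDriftTransferTools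

open Summit.AtomisticToContinuum.HydrodynamicLimit.Theorems.CollisionActivityTailsEndpointTails
  (tailFn tailFn_of_lt tailFn_of_le)

/-! ## General measure-theoretic tools -/

section Tools

variable {Ω : Type*} [MeasurableSpace Ω] {μ : Measure Ω}

/-- **Markov's inequality, real-valued form**: for an a.e.-measurable `f` and a positive level `c`,
`ofReal c · μ{c ≤ f} ≤ ∫⁻ ofReal f`. [folklore] -/
theorem ofReal_mul_meas_ge_le_lintegral {f : Ω → ℝ} (hf : AEMeasurable f μ) (c : ℝ) :
    ENNReal.ofReal c * μ {ω | c ≤ f ω} ≤ ∫⁻ ω, ENNReal.ofReal (f ω) ∂μ := by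
  have h := mul_meas_ge_le_lintegral₀ (ENNReal.measurable_ofReal.comp_aemeasurable hf) (ENNReal.ofReal c)
  refine le_trans (mul_le_mul_of_nonneg_left (measure_mono fun ω (hω : c ≤ f ω) => ?_) (zero_le)) h
  exact ENNReal.ofReal_le_ofReal hω

/-- Markov in product form: `μ{c ≤ f} ≤ (ofReal c)⁻¹ · ∫⁻ ofReal f` for `0 < c`. [folklore] -/
theorem meas_ge_le_inv_mul_lintegral {f : Ω → ℝ} (hf : AEMeasurable f μ) {c : ℝ} (hc : 0 < c) :
    μ {ω | c ≤ f ω} ≤ (ENNReal.ofReal c)⁻¹ * ∫⁻ ω, ENNReal.ofReal (f ω) ∂μ := by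
  have hc0 : ENNReal.ofReal c ≠ 0 := (ENNReal.ofReal_pos.2 hc).ne'
  calc μ {ω | c ≤ f ω} = (ENNReal.ofReal c)⁻¹ * (ENNReal.ofReal c * μ {ω | c ≤ f ω}) := by
        rw [← mul_assoc, ENNReal.inv_mul_cancel hc0 ENNReal.ofReal_ne_top, one_mul]
    _ ≤ (ENNReal.ofReal c)⁻¹ * ∫⁻ ω, ENNReal.ofReal (f ω) ∂μ :=
        mul_le_mul_of_nonneg_left (ofReal_mul_meas_ge_le_lintegral hf c) (zero_le)

/-- Linearity of `∫⁻ ofReal` over an empirical average of nonnegative a.e.-measurable functions: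
`∫⁻ ofReal ((n+1)⁻¹ Σ_i g i) = ofReal ((n+1)⁻¹) · Σ_i ∫⁻ ofReal (g i)`. [folklore] -/
theorem lintegral_ofReal_average_eq {n : ℕ} (g : Fin (n + 1) → Ω → ℝ) (hgm : ∀ i, AEMeasurable (g i) μ)
    (hg0 : ∀ i ω, 0 ≤ g i ω) :
    ∫⁻ ω, ENNReal.ofReal (((n : ℝ) + 1)⁻¹ * ∑ i : Fin (n + 1), g i ω) ∂μ =
      ENNReal.ofReal (((n : ℝ) + 1)⁻¹) * ∑ i : Fin (n + 1), ∫⁻ ω, ENNReal.ofReal (g i ω) ∂μ := by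
  have hn : (0 : ℝ) < (n : ℝ) + 1 := by positivity
  have hmeas : ∀ i, AEMeasurable (fun ω => ENNReal.ofReal (g i ω)) μ := fun i =>
    ENNReal.measurable_ofReal.comp_aemeasurable (hgm i)
  calc ∫⁻ ω, ENNReal.ofReal (((n : ℝ) + 1)⁻¹ * ∑ i : Fin (n + 1), g i ω) ∂μ
      = ∫⁻ ω, ENNReal.ofReal (((n : ℝ) + 1)⁻¹) * ∑ i : Fin (n + 1), ENNReal.ofReal (g i ω) ∂μ := by
        refine lintegral_congr fun ω => ?_
        rw [ENNReal.ofReal_mul (inv_nonneg.2 hn.le), ENNReal.ofReal_sum_of_nonneg fun i _ => hg0 i ω]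
    _ = ENNReal.ofReal (((n : ℝ) + 1)⁻¹) * ∑ i : Fin (n + 1), ∫⁻ ω, ENNReal.ofReal (g i ω) ∂μ := by
        rw [lintegral_const_mul' _ _ ENNReal.ofReal_ne_top, lintegral_finsetSum' _ fun i _ => hmeas i]

/-- Sum form of an averaged bound: if `∫⁻ ofReal ((n+1)⁻¹ Σ_i g i) ≤ ofReal B` for nonnegative a.e.-measurable
`g i` then `Σ_i ∫⁻ ofReal (g i) ≤ ofReal ((n+1) B)`. [folklore] -/
theorem sum_lintegral_le_of_average_le {n : ℕ} (g : Fin (n + 1) → Ω → ℝ) (hgm : ∀ i, AEMeasurable (g i) μ)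
    (hg0 : ∀ i ω, 0 ≤ g i ω) (B : ℝ)
    (h : ∫⁻ ω, ENNReal.ofReal (((n : ℝ) + 1)⁻¹ * ∑ i : Fin (n + 1), g i ω) ∂μ ≤ ENNReal.ofReal B) :
    ∑ i : Fin (n + 1), ∫⁻ ω, ENNReal.ofReal (g i ω) ∂μ ≤ ENNReal.ofReal (((n : ℝ) + 1) * B) := by
  have hn : (0 : ℝ) < (n : ℝ) + 1 := by positivity
  rw [lintegral_ofReal_average_eq g hgm hg0] at h
  have hone : ENNReal.ofReal ((n : ℝ) + 1) * ENNReal.ofReal (((n : ℝ) + 1)⁻¹) = 1 := by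
    rw [← ENNReal.ofReal_mul hn.le, mul_inv_cancel₀ hn.ne', ENNReal.ofReal_one]
  calc ∑ i : Fin (n + 1), ∫⁻ ω, ENNReal.ofReal (g i ω) ∂μ
      = ENNReal.ofReal ((n : ℝ) + 1) *
          (ENNReal.ofReal (((n : ℝ) + 1)⁻¹) * ∑ i : Fin (n + 1), ∫⁻ ω, ENNReal.ofReal (g i ω) ∂μ) := by
        rw [← mul_assoc, hone, one_mul]
    _ ≤ ENNReal.ofReal ((n : ℝ) + 1) * ENNReal.ofReal B := by gcongr
    _ = ENNReal.ofReal (((n : ℝ) + 1) * B) := (ENNReal.ofReal_mul hn.le).symm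

/-- The hinge of an average is at most the average of the hinges:
`((K+1)⁻¹ Σ_{j ≤ K} x_j − M)₊ ≤ (K+1)⁻¹ Σ_{j ≤ K} (x_j − M)₊`. [folklore] -/
theorem hinge_average_le (K : ℕ) (x : ℕ → ℝ) (M : ℝ) :
    max (((K : ℝ) + 1)⁻¹ * ∑ j ∈ Finset.range (K + 1), x j - M) 0 ≤
      ((K : ℝ) + 1)⁻¹ * ∑ j ∈ Finset.range (K + 1), max (x j - M) 0 := by
  have hK : (0 : ℝ) < (K : ℝ) + 1 := by positivity
  refine max_le ?_ ?_
  · have hsum : ∑ j ∈ Finset.range (K + 1), x j - ((K : ℝ) + 1) * M ≤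
        ∑ j ∈ Finset.range (K + 1), max (x j - M) 0 := by
      have : ∑ j ∈ Finset.range (K + 1), (x j - M) ≤ ∑ j ∈ Finset.range (K + 1), max (x j - M) 0 :=
        Finset.sum_le_sum fun j _ => le_max_left _ _
      rw [Finset.sum_sub_distrib, Finset.sum_const, Finset.card_range, nsmul_eq_mul, Nat.cast_add_one] at this
      linarith
    have h1 : ((K : ℝ) + 1)⁻¹ * ∑ j ∈ Finset.range (K + 1), x j - M =
        ((K : ℝ) + 1)⁻¹ * (∑ j ∈ Finset.range (K + 1), x j - ((K : ℝ) + 1) * M) := by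
      field_simp
    rw [h1]
    exact mul_le_mul_of_nonneg_left hsum (inv_nonneg.2 hK.le)
  · exact mul_nonneg (inv_nonneg.2 hK.le) (Finset.sum_nonneg fun j _ => le_max_right _ _)

/-- **The pointwise tail-to-hinge step.**  If `0 ≤ a ≤ 2b`, `0 ≤ M'` and `2V_e ≤ V`, then
`a𝟙{V < a} ≤ 2(b − M')₊ + 2M'𝟙{V_e < b}`. [folklore] -/
theorem tailFn_le_hinge_add_indicator {a b V Ve M' : ℝ} (hab : a ≤ 2 * b) (hM' : 0 ≤ M')
    (hV : 2 * Ve ≤ V) :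
    tailFn V a ≤ 2 * max (b - M') 0 + 2 * M' * Set.indicator {y : ℝ | Ve < y} (fun _ => (1 : ℝ)) b := by
  by_cases h : V < a
  · rw [tailFn_of_lt h]
    have hb : Ve < b := by linarith
    rw [Set.indicator_of_mem (show b ∈ {y : ℝ | Ve < y} from hb), mul_one]
    have : b ≤ max (b - M') 0 + M' := by
      have := le_max_left (b - M') 0
      linarith
    linarith
  · rw [tailFn_of_le (not_lt.1 h)]
    have h1 : 0 ≤ Set.indicator {y : ℝ | Ve < y} (fun _ => (1 : ℝ)) b :=
      Set.indicator_nonneg (fun _ _ => zero_le_one) _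
    positivity

/-- Linearity of `∫⁻ ofReal` over a nonnegative scalar multiple of a finite sum of nonnegative a.e.-measurable
functions. [folklore] -/
theorem lintegral_ofReal_mul_sum {ι : Type*} (s : Finset ι) (f : ι → Ω → ℝ) (hfm : ∀ j ∈ s, AEMeasurable (f j) μ)
    (hf0 : ∀ j ∈ s, ∀ ω, 0 ≤ f j ω) {c : ℝ} (hc : 0 ≤ c) :
    ∫⁻ ω, ENNReal.ofReal (c * ∑ j ∈ s, f j ω) ∂μ = ENNReal.ofReal c * ∑ j ∈ s, ∫⁻ ω, ENNReal.ofReal (f j ω) ∂μ := by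
  have hmeas : ∀ j ∈ s, AEMeasurable (fun ω => ENNReal.ofReal (f j ω)) μ := fun j hj =>
    ENNReal.measurable_ofReal.comp_aemeasurable (hfm j hj)
  calc ∫⁻ ω, ENNReal.ofReal (c * ∑ j ∈ s, f j ω) ∂μ
      = ∫⁻ ω, ENNReal.ofReal c * ∑ j ∈ s, ENNReal.ofReal (f j ω) ∂μ := by
        refine lintegral_congr fun ω => ?_
        rw [ENNReal.ofReal_mul hc, ENNReal.ofReal_sum_of_nonneg fun j hj => hf0 j hj ω]
    _ = ENNReal.ofReal c * ∑ j ∈ s, ∫⁻ ω, ENNReal.ofReal (f j ω) ∂μ := by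
        rw [lintegral_const_mul' _ _ ENNReal.ofReal_ne_top, lintegral_finsetSum' _ hmeas]

/-- `∫⁻ ofReal` of a finite sum of nonnegative a.e.-measurable functions is the sum of the integrals. [folklore] -/
theorem lintegral_ofReal_sum {ι : Type*} (s : Finset ι) (f : ι → Ω → ℝ) (hfm : ∀ j ∈ s, AEMeasurable (f j) μ)
    (hf0 : ∀ j ∈ s, ∀ ω, 0 ≤ f j ω) :
    ∫⁻ ω, ENNReal.ofReal (∑ j ∈ s, f j ω) ∂μ = ∑ j ∈ s, ∫⁻ ω, ENNReal.ofReal (f j ω) ∂μ := by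
  have h := lintegral_ofReal_mul_sum s f hfm hf0 zero_le_one
  simpa only [one_mul, ENNReal.ofReal_one] using h

/-- The indicator integrand: `∫⁻ ofReal (c · 𝟙_{V < f}) = ofReal c · μ{V < f}` for a.e.-measurable `f`.
[folklore] -/
theorem lintegral_ofReal_const_mul_indicator {f : Ω → ℝ} (hf : AEMeasurable f μ) (c V : ℝ) :
    ∫⁻ ω, ENNReal.ofReal (c * Set.indicator {y : ℝ | V < y} (fun _ => (1 : ℝ)) (f ω)) ∂μ =
      ENNReal.ofReal c * μ {ω | V < f ω} := by
  have hset : NullMeasurableSet {ω | V < f ω} μ := nullMeasurableSet_lt aemeasurable_const hf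
  have hpt : ∀ ω, ENNReal.ofReal (c * Set.indicator {y : ℝ | V < y} (fun _ => (1 : ℝ)) (f ω)) =
      ENNReal.ofReal c * Set.indicator {ω | V < f ω} (1 : Ω → ℝ≥0∞) ω := by
    intro ω
    by_cases h : V < f ω
    · rw [Set.indicator_of_mem (show f ω ∈ {y : ℝ | V < y} from h),
        Set.indicator_of_mem (show ω ∈ {ω | V < f ω} from h), Pi.one_apply, mul_one, mul_one]
    · rw [Set.indicator_of_notMem (show f ω ∉ {y : ℝ | V < y} from h),
        Set.indicator_of_notMem (show ω ∉ {ω | V < f ω} from h), mul_zero, mul_zero, ENNReal.ofReal_zero]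
  simp_rw [hpt]
  rw [lintegral_const_mul' _ _ ENNReal.ofReal_ne_top, lintegral_indicator_one₀ hset]

end Tools

/-! ## The hinge part and the block means (abstract probability space, `n + 1` spheres) -/

section FixedN

variable {Ω : Type} [MeasurableSpace Ω] {P : Measure Ω} [IsProbabilityMeasure P] {n : ℕ}
  {X : Fin (n + 1) → ℕ → Ω → ℝ}

omit [IsProbabilityMeasure P] in
/-- **Hinge part.**  `Σ_i E (ā_i − M')₊ ≤ (n+1)·B` if every block has `E[(n+1)⁻¹Σ_i (X_{ij} − M')₊] ≤ B`
(convexity of the hinge, then the block-wise bounds). -/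
theorem sum_lintegral_hinge_average_le (hXm : ∀ i j, AEMeasurable (X i j) P) (K : ℕ) (M' B : ℝ)
    (hUI : ∀ j, j < K + 1 →
      ∫⁻ ω, ENNReal.ofReal (((n : ℝ) + 1)⁻¹ * ∑ i : Fin (n + 1), max (X i j ω - M') 0) ∂P ≤ ENNReal.ofReal B) :
    ∑ i : Fin (n + 1), ∫⁻ ω, ENNReal.ofReal
        (max (((K : ℝ) + 1)⁻¹ * ∑ j ∈ Finset.range (K + 1), X i j ω - M') 0) ∂P ≤
      ENNReal.ofReal (((n : ℝ) + 1) * B) := by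
  have hKpos : (0 : ℝ) < (K : ℝ) + 1 := by positivity
  have hstep : ∀ i, ∫⁻ ω, ENNReal.ofReal
      (max (((K : ℝ) + 1)⁻¹ * ∑ j ∈ Finset.range (K + 1), X i j ω - M') 0) ∂P ≤
      ENNReal.ofReal (((K : ℝ) + 1)⁻¹) *
        ∑ j ∈ Finset.range (K + 1), ∫⁻ ω, ENNReal.ofReal (max (X i j ω - M') 0) ∂P := by
    intro i
    calc ∫⁻ ω, ENNReal.ofReal (max (((K : ℝ) + 1)⁻¹ * ∑ j ∈ Finset.range (K + 1), X i j ω - M') 0) ∂P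
        ≤ ∫⁻ ω, ENNReal.ofReal (((K : ℝ) + 1)⁻¹ *
            ∑ j ∈ Finset.range (K + 1), max (X i j ω - M') 0) ∂P :=
          lintegral_mono fun ω => ENNReal.ofReal_le_ofReal (hinge_average_le K (fun j => X i j ω) M')
      _ = ENNReal.ofReal (((K : ℝ) + 1)⁻¹) *
            ∑ j ∈ Finset.range (K + 1), ∫⁻ ω, ENNReal.ofReal (max (X i j ω - M') 0) ∂P :=
          lintegral_ofReal_mul_sum (Finset.range (K + 1)) (fun j ω => max (X i j ω - M') 0)
            (fun j _ => ((hXm i j).sub_const M').max aemeasurable_const)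
            (fun j _ ω => le_max_right _ _) (inv_nonneg.2 hKpos.le)
  have hcastK : ((K + 1 : ℕ) : ℝ≥0∞) = ENNReal.ofReal ((K : ℝ) + 1) := by
    rw [← ENNReal.ofReal_natCast]
    push_cast
    rfl
  calc ∑ i : Fin (n + 1), ∫⁻ ω, ENNReal.ofReal
          (max (((K : ℝ) + 1)⁻¹ * ∑ j ∈ Finset.range (K + 1), X i j ω - M') 0) ∂P
      ≤ ∑ i : Fin (n + 1), ENNReal.ofReal (((K : ℝ) + 1)⁻¹) *
          ∑ j ∈ Finset.range (K + 1), ∫⁻ ω, ENNReal.ofReal (max (X i j ω - M') 0) ∂P :=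
        Finset.sum_le_sum fun i _ => hstep i
    _ = ENNReal.ofReal (((K : ℝ) + 1)⁻¹) *
          ∑ j ∈ Finset.range (K + 1), ∑ i : Fin (n + 1), ∫⁻ ω, ENNReal.ofReal (max (X i j ω - M') 0) ∂P := by
        rw [← Finset.mul_sum, Finset.sum_comm]
    _ ≤ ENNReal.ofReal (((K : ℝ) + 1)⁻¹) * ∑ _j ∈ Finset.range (K + 1), ENNReal.ofReal (((n : ℝ) + 1) * B) := by
        gcongr with j hj
        exact sum_lintegral_le_of_average_le (fun i ω => max (X i j ω - M') 0)
          (fun i => ((hXm i j).sub_const M').max aemeasurable_const) (fun i ω => le_max_right _ _) _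
          (hUI j (Finset.mem_range.1 hj))
    _ = ENNReal.ofReal (((n : ℝ) + 1) * B) := by
        rw [Finset.sum_const, Finset.card_range, nsmul_eq_mul, hcastK, ← mul_assoc,
          ENNReal.ofReal_inv_of_pos hKpos,
          ENNReal.inv_mul_cancel (ENNReal.ofReal_pos.2 hKpos).ne' ENNReal.ofReal_ne_top, one_mul]

/-- **Block means.**  `Σ_i E X_{ij} ≤ (n+1)(M + δ)` if `E[(n+1)⁻¹Σ_i (X_{ij} − M)₊] ≤ δ`
(`X ≤ M + (X − M)₊` on a probability space). -/
theorem sum_lintegral_le_of_overshoot (hXm : ∀ i j, AEMeasurable (X i j) P) (hX0 : ∀ i j ω, 0 ≤ X i j ω)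
    {M δ : ℝ} (hM : 0 ≤ M) (hδ : 0 ≤ δ) (j : ℕ)
    (hUI : ∫⁻ ω, ENNReal.ofReal (((n : ℝ) + 1)⁻¹ * ∑ i : Fin (n + 1), max (X i j ω - M) 0) ∂P ≤ ENNReal.ofReal δ) :
    ∑ i : Fin (n + 1), ∫⁻ ω, ENNReal.ofReal (X i j ω) ∂P ≤ ENNReal.ofReal (((n : ℝ) + 1) * (M + δ)) := by
  have hsum := sum_lintegral_le_of_average_le (fun i ω => max (X i j ω - M) 0)
    (fun i => ((hXm i j).sub_const M).max aemeasurable_const) (fun i ω => le_max_right _ _) _ hUI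
  have hcastN : ((n + 1 : ℕ) : ℝ≥0∞) = ENNReal.ofReal ((n : ℝ) + 1) := by
    rw [← ENNReal.ofReal_natCast]
    push_cast
    rfl
  have _h := hX0
  calc ∑ i : Fin (n + 1), ∫⁻ ω, ENNReal.ofReal (X i j ω) ∂P
      ≤ ∑ i : Fin (n + 1), (∫⁻ _ω, ENNReal.ofReal M ∂P + ∫⁻ ω, ENNReal.ofReal (max (X i j ω - M) 0) ∂P) := by
        refine Finset.sum_le_sum fun i _ => ?_
        rw [← lintegral_add_left' aemeasurable_const]
        refine lintegral_mono fun ω => ?_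
        rw [← ENNReal.ofReal_add hM (le_max_right _ _)]
        exact ENNReal.ofReal_le_ofReal (by linarith [le_max_left (X i j ω - M) 0])
    _ = ∑ _i : Fin (n + 1), ∫⁻ _ω, ENNReal.ofReal M ∂P +
          ∑ i : Fin (n + 1), ∫⁻ ω, ENNReal.ofReal (max (X i j ω - M) 0) ∂P := Finset.sum_add_distrib
    _ ≤ ENNReal.ofReal (((n : ℝ) + 1) * M) + ENNReal.ofReal (((n : ℝ) + 1) * δ) := by
        refine add_le_add (le_of_eq ?_) hsum
        simp only [lintegral_const, measure_univ, mul_one, Finset.sum_const, Finset.card_univ,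
          Fintype.card_fin, nsmul_eq_mul]
        rw [hcastN, ← ENNReal.ofReal_mul (by positivity)]
    _ = ENNReal.ofReal (((n : ℝ) + 1) * (M + δ)) := by
        rw [← ENNReal.ofReal_add (by positivity) (by positivity)]
        ring_nf

end FixedN

/-- **Registered sub-goal `stub_driftTransferHingePart`** (line `Sketch`, lead a1; route-internal, not a cited
fact): the hinge part of the transfer — on any probability space with `n + 1` spheres and a.e.-measurable block
activities, block-wise bounds `E[(n+1)⁻¹Σ_i (X_{ij} − M')₊] ≤ B` for the `K + 1` blocks give
`Σ_i E((K+1)⁻¹Σ_{j≤K} X_{ij} − M')₊ ≤ (n+1)B`. -/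
def DriftTransferHingePart : Prop :=
  ∀ (Ω : Type) [MeasurableSpace Ω] (P : Measure Ω) (n : ℕ) (X : Fin (n + 1) → ℕ → Ω → ℝ),
    (∀ i j, AEMeasurable (X i j) P) → ∀ (K : ℕ) (M' B : ℝ),
    (∀ j, j < K + 1 →
      ∫⁻ ω, ENNReal.ofReal (((n : ℝ) + 1)⁻¹ * ∑ i : Fin (n + 1), max (X i j ω - M') 0) ∂P ≤ ENNReal.ofReal B) →
    ∑ i : Fin (n + 1), ∫⁻ ω, ENNReal.ofReal
        (max (((K : ℝ) + 1)⁻¹ * ∑ j ∈ Finset.range (K + 1), X i j ω - M') 0) ∂P ≤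
      ENNReal.ofReal (((n : ℝ) + 1) * B)

/-- The registered sub-goal `stub_driftTransferHingePart` holds (`sum_lintegral_hinge_average_le`). -/
theorem stub_driftTransferHingePart : DriftTransferHingePart :=
  fun _Ω _ _P _n _X hXm K M' B hUI => sum_lintegral_hinge_average_le hXm K M' B hUI

end Summit.AtomisticToContinuum.HydrodynamicLimit.Theorems.TransferActivityTailsDriftTransferTools

end
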